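import Mathlib.Analysis.InnerProductSpace.Basic
import HarnessLib

/-!
# Small-range regularity, TWISTED — FILE 3a-τ: the real-variable arithmetic of the Campanato iteration with a source

SEAT ym3-torus-px7 g5 (helper for `stmt-QuantumFields-19936`, K2 END-GAME lane [D]).  Pure real-variable lemmas consumed by FILE 3-τ
(`PoincareLipschitzSphereMapSmallRangeHolderTwisted`): the downward geometric iteration WITH A SOURCE (`geometric_iter_add`), the geometric sum `Σ_{k<K} m^k ≤ m^K`,
the step factor `4A(2∕m)^d + (8A+4)2ω ≤ m^{−(d−1)}`, the identity `θ^k(m^k)^d = m^k` for `θ = m^{−(d−1)}`, the decayed source `θ^k·P(2m^{k+1}−3)^d ≤ P2^dm^d·m^k`, and the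
top-scale bracket arithmetic.  No lattice objects.
HONEST SCOPE.  [folklore] ([Giaquinta1984] Ch. III Lemma 2.1 p.86).  Proves nothing of `hImprove`∕`hRegH`∕`stmt-QuantumFields-19936`; YM₃ on T³ is rung R3, not Clay.
-/

set_option autoImplicit false

noncomputable section

open scoped BigOperators
open Finset

namespace Summit.QuantumFields.YangMills.Theorems.PoincareLipschitzSphereMapSmallRangeIterationArith

variable {d : ℕ}

/-- Downward geometric iteration WITH A SOURCE: `E k ≤ θ·E(k+1) + S k` for `k < K` (`θ ≥ 0`) gives `E 0 ≤ θ^K·E K + Σ_{k<K} θ^k·S k`.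
[folklore] [cite: Giaquinta1984, Ch. III Lemma 2.1 p.86] -/
theorem geometric_iter_add (E S : ℕ → ℝ) {θ : ℝ} (hθ : 0 ≤ θ) (K : ℕ) (hstep : ∀ k, k < K → E k ≤ θ * E (k + 1) + S k) :
    E 0 ≤ θ ^ K * E K + ∑ k ∈ Finset.range K, θ ^ k * S k := by
  induction K with
  | zero => simp
  | succ K ih =>
    have h1 := ih fun k hk => hstep k (Nat.lt_succ_of_lt hk)
    have h2 : E K ≤ θ * E (K + 1) + S K := hstep K (Nat.lt_succ_self K)
    have h3 : θ ^ K * E K ≤ θ ^ K * (θ * E (K + 1) + S K) := mul_le_mul_of_nonneg_left h2 (pow_nonneg hθ K)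
    rw [Finset.sum_range_succ, pow_succ]
    nlinarith [h1, h3]

/-- `Σ_{k<K} m^k ≤ m^K` for `m ≥ 2`. [folklore] -/
theorem sum_pow_le_pow {m : ℝ} (hm : 2 ≤ m) (K : ℕ) : ∑ k ∈ Finset.range K, m ^ k ≤ m ^ K := by
  induction K with
  | zero => simp
  | succ K ih =>
    rw [Finset.sum_range_succ, pow_succ]
    have h0 : 0 ≤ m ^ K := pow_nonneg (by linarith) K
    nlinarith [ih, h0]

/-- The top-scale arithmetic: with `s = ω + τ₀ ≤ 1`, `0 ≤ ω, τ₀, τ₁`, `M ≥ 1`,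
`M·(2·(448d·s²∕M² + 96d·sτ₀∕M + 16τ₁ + 704dτ₀²) + 2dτ₀²) ≤ 1792d·ω²∕M + (3394d + 32)·(τ₀ + τ₁)·M`. [folklore] -/
theorem top_scale_arith {dR M ω τ₀ τ₁ : ℝ} (hd : 1 ≤ dR) (hM : 1 ≤ M) (hω0 : 0 ≤ ω) (hτ0 : 0 ≤ τ₀) (hτ1 : 0 ≤ τ₁) (hωτ : ω + τ₀ ≤ 1) :
    M * (2 * (448 * dR * (ω + τ₀) ^ 2 / M ^ 2 + 96 * dR * ((ω + τ₀) * τ₀) / M + 16 * τ₁ + 704 * dR * τ₀ ^ 2) + 2 * dR * τ₀ ^ 2) ≤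
      1792 * dR * ω ^ 2 / M + (3394 * dR + 32) * (τ₀ + τ₁) * M := by
  have hM0 : 0 < M := by linarith
  have hd0 : 0 ≤ dR := by linarith
  have hτ01 : τ₀ ≤ 1 := by linarith
  have hτsq : τ₀ ^ 2 ≤ τ₀ := by nlinarith
  -- expand the left side
  have e : M * (2 * (448 * dR * (ω + τ₀) ^ 2 / M ^ 2 + 96 * dR * ((ω + τ₀) * τ₀) / M + 16 * τ₁ + 704 * dR * τ₀ ^ 2) + 2 * dR * τ₀ ^ 2) =
      896 * dR * (ω + τ₀) ^ 2 / M + 192 * dR * ((ω + τ₀) * τ₀) + 32 * τ₁ * M + 1410 * dR * τ₀ ^ 2 * M := by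
    field_simp
    ring
  rw [e]
  -- term by term
  have t1 : 896 * dR * (ω + τ₀) ^ 2 / M ≤ 1792 * dR * ω ^ 2 / M + 1792 * dR * τ₀ * M := by
    have hsq : (ω + τ₀) ^ 2 ≤ 2 * ω ^ 2 + 2 * τ₀ ^ 2 := by nlinarith [sq_nonneg (ω - τ₀)]
    have a1 : 896 * dR * (ω + τ₀) ^ 2 / M ≤ 896 * dR * (2 * ω ^ 2 + 2 * τ₀ ^ 2) / M :=
      div_le_div_of_nonneg_right (mul_le_mul_of_nonneg_left hsq (by positivity)) hM0.le
    have a2 : 896 * dR * (2 * ω ^ 2 + 2 * τ₀ ^ 2) / M = 1792 * dR * ω ^ 2 / M + 1792 * dR * τ₀ ^ 2 / M := by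
      field_simp; ring
    have a3 : 1792 * dR * τ₀ ^ 2 / M ≤ 1792 * dR * τ₀ * M := by
      rw [div_le_iff₀ hM0]
      have hMM : 1 ≤ M * M := by nlinarith
      have : τ₀ ^ 2 ≤ τ₀ * (M * M) := by
        calc τ₀ ^ 2 ≤ τ₀ := hτsq
          _ = τ₀ * 1 := (mul_one _).symm
          _ ≤ τ₀ * (M * M) := mul_le_mul_of_nonneg_left hMM hτ0
      nlinarith [mul_le_mul_of_nonneg_left this (by positivity : (0 : ℝ) ≤ 1792 * dR)]
    linarith
  have t2 : 192 * dR * ((ω + τ₀) * τ₀) ≤ 192 * dR * τ₀ * M := by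
    have : (ω + τ₀) * τ₀ ≤ τ₀ * M := by nlinarith [mul_nonneg hτ0 (by linarith : (0 : ℝ) ≤ M - 1)]
    nlinarith [mul_le_mul_of_nonneg_left this (by positivity : (0 : ℝ) ≤ 192 * dR)]
  have t3 : 1410 * dR * τ₀ ^ 2 * M ≤ 1410 * dR * τ₀ * M := by
    have := mul_le_mul_of_nonneg_left hτsq (by positivity : (0 : ℝ) ≤ 1410 * dR * M)
    nlinarith [this]
  have t4 : 32 * τ₁ * M ≤ 32 * dR * τ₁ * M := by
    have := mul_le_mul_of_nonneg_right hd (by positivity : (0 : ℝ) ≤ 32 * τ₁ * M)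
    nlinarith [this]
  nlinarith [t1, t2, t3, t4, mul_nonneg (mul_nonneg hd0 hτ1) hM0.le, mul_nonneg (mul_nonneg hd0 hτ0) hM0.le]

/-- The step factor: `4A·q + (8A+4)·2ω ≤ m^{−(d−1)}` when `q ≤ (2∕m)^d`, `m ≥ 8A·2^d + 4`, `ω ≤ m^{−(d−1)}∕(4(8A+4))`. [folklore] -/
theorem step_factor_le (hd : 1 ≤ d) {A mR ω q : ℝ} (hA0 : 0 ≤ A) (h2d : (1 : ℝ) ≤ (2 : ℝ) ^ d) (hm : 8 * A * 2 ^ d + 4 ≤ mR)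
    (hωsmall : ω ≤ (mR ^ (d - 1))⁻¹ / (4 * (8 * A + 4))) (hq : q ≤ (2 / mR) ^ d) :
    4 * A * q + (8 * A + 4) * (2 * ω) ≤ (mR ^ (d - 1))⁻¹ := by
  have hm0 : 0 < mR := by nlinarith
  set θ : ℝ := (mR ^ (d - 1))⁻¹ with hθ
  have t1 : 4 * A * (2 / mR) ^ d ≤ θ / 2 := by
    set M1 : ℝ := mR ^ (d - 1) with hM1
    have hM1pos : 0 < M1 := by positivity
    have hd1 : d - 1 + 1 = d := by omega
    have hmd : mR ^ d = M1 * mR := by rw [hM1, ← pow_succ, hd1]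
    rw [hθ, div_pow, hmd, show M1⁻¹ / 2 = 1 / (2 * M1) by field_simp, show 4 * A * (2 ^ d / (M1 * mR)) = (4 * A * 2 ^ d) / (M1 * mR) by ring,
      div_le_div_iff₀ (by positivity) (by positivity), one_mul]
    have h8 : 8 * A * 2 ^ d ≤ mR := by linarith
    calc 4 * A * 2 ^ d * (2 * M1) = (8 * A * 2 ^ d) * M1 := by ring
      _ ≤ mR * M1 := mul_le_mul_of_nonneg_right h8 hM1pos.le
      _ = M1 * mR := mul_comm _ _
  have t2 : (8 * A + 4) * (2 * ω) ≤ θ / 2 := by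
    have hpos : (0 : ℝ) < 8 * A + 4 := by positivity
    calc (8 * A + 4) * (2 * ω) ≤ (8 * A + 4) * (2 * (θ / (4 * (8 * A + 4)))) := by gcongr
      _ = θ / 2 := by field_simp; ring
  have t3 := mul_le_mul_of_nonneg_left hq (by positivity : (0 : ℝ) ≤ 4 * A)
  linarith

/-- `θ^k·(m^k)^d = m^k` for `θ = m^{−(d−1)}`, `d ≥ 1`, `m > 0`. [folklore] -/
theorem theta_pow_mul_pow (hd : 1 ≤ d) {mR : ℝ} (hm0 : 0 < mR) (k : ℕ) : ((mR ^ (d - 1))⁻¹) ^ k * (mR ^ k) ^ d = mR ^ k := by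
  have e1 : ((mR ^ (d - 1))⁻¹) ^ k = ((mR ^ k) ^ (d - 1))⁻¹ := by rw [inv_pow, ← pow_mul, ← pow_mul, mul_comm]
  have e2 : (mR ^ k) ^ d = (mR ^ k) ^ (d - 1) * mR ^ k := by rw [← pow_succ]; congr 1; omega
  have hpos : (0 : ℝ) < (mR ^ k) ^ (d - 1) := by positivity
  rw [e1, e2, ← mul_assoc, inv_mul_cancel₀ hpos.ne', one_mul]

/-- The decayed source term: `θ^k·(P·(2m^{k+1} − 3)^d) ≤ P·2^d·m^d·m^k` (`P ≥ 0`, `m ≥ 4`, `θ = m^{−(d−1)}`). [folklore] -/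
theorem source_term_le (hd : 1 ≤ d) {mR P : ℝ} (hm4 : 4 ≤ mR) (hP : 0 ≤ P) (k : ℕ) :
    ((mR ^ (d - 1))⁻¹) ^ k * (P * (2 * mR ^ (k + 1) - 3) ^ d) ≤ P * (2 : ℝ) ^ d * mR ^ d * mR ^ k := by
  have hm0 : 0 < mR := by linarith
  have hm1 : 1 ≤ mR := by linarith
  have hmk4 : (4 : ℝ) ≤ mR ^ (k + 1) := by
    calc (4 : ℝ) ≤ mR := hm4
      _ = mR ^ 1 := (pow_one _).symm
      _ ≤ mR ^ (k + 1) := pow_le_pow_right₀ hm1 (by omega)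
  have hcle : (2 * mR ^ (k + 1) - 3) ^ d ≤ (2 : ℝ) ^ d * mR ^ d * (mR ^ k) ^ d := by
    calc (2 * mR ^ (k + 1) - 3) ^ d ≤ (2 * mR ^ (k + 1)) ^ d := pow_le_pow_left₀ (by linarith) (by linarith) d
      _ = (2 : ℝ) ^ d * mR ^ d * (mR ^ k) ^ d := by rw [pow_succ, mul_pow, mul_pow]; ring
  have hθ0 : 0 ≤ ((mR ^ (d - 1))⁻¹) ^ k := by positivity
  calc ((mR ^ (d - 1))⁻¹) ^ k * (P * (2 * mR ^ (k + 1) - 3) ^ d) ≤ ((mR ^ (d - 1))⁻¹) ^ k * (P * ((2 : ℝ) ^ d * mR ^ d * (mR ^ k) ^ d)) :=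
        mul_le_mul_of_nonneg_left (mul_le_mul_of_nonneg_left hcle hP) hθ0
    _ = P * (2 : ℝ) ^ d * mR ^ d * (((mR ^ (d - 1))⁻¹) ^ k * (mR ^ k) ^ d) := by ring
    _ = P * (2 : ℝ) ^ d * mR ^ d * mR ^ k := by rw [theta_pow_mul_pow hd hm0 k]

end Summit.QuantumFields.YangMills.Theorems.PoincareLipschitzSphereMapSmallRangeIterationArith

end
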